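/-
Copyright: the b2b-balaban T⁴-continuum CRUX team, row NE7b OWNER lineage `t4-ne7b-p1` (gen 117). Project licence.
-/
import Summits.QuantumFields.BalabanUV.T4Continuum.Spine.NE7b.SupTorusActionMinimiser
import Summits.QuantumFields.BalabanUV.T4Continuum.Spine.NE7b.SupBackgroundTorusLocalised

/-!
# SBTL's TORUS BACKGROUND IS THE RESTRICTION OF A GLOBALLY DEFINED BACKGROUND MAP (when `λ < min(2,a)`): for SBTL's localised
# small-field background `σt` of the perturbed Gaussian skeleton on `(ℤ∕(n+1)s)^d` (`d ≥ 3`, SBTL's binders VERBATIM) with the extra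
# letter `λ < min(2,a)`, there is a map `Φ` on the WHOLE coarse carrier — the unique solution of the sitewise equation on each
# block-average fibre ((93)), the minimiser of the torus action there — and `σt wt = Φ wt` on SBTL's closed chart ball: the sup
# road's chart background and the convexity column's global background are ONE object where both exist
# (row NE7b, node U5c; (93) `existsUnique_torus_background` + SBTL `exists_background_torus_localised` BY NAME; [folklore])

Cell `pub-balaban`, sub-cell `t4`, spine estimate NE7b (`T4WeightBudget.RelWeightBound`; the cell's OWN estimate — NOT PRINTED in
[Bałaban 1983–89], NOT PROVED).  Crux-route work under `Spine/NE7b/` by the row OWNER (`t4-ne7b-p1` gen 117) under FREEZE (0)'s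
crux-prover clause; NOTHING of Bałaban's is named as a Lean object, valued or asserted; no `T4Continuum/Support` leaf typed; no `def`,
no notation (the global map is produced existentially from (93)'s `∃!`); zero `sorry`.  Imports (BY NAME): the OWNER's (93)
`…SupTorusActionMinimiser` (`existsUnique_torus_background`) and leaf-03's SBTL `…SupBackgroundTorusLocalised`
(`exists_background_torus_localised`).

WHY (located).  Two constructions of «the background» now live in the tree: the sup road's `σt` (ASE ∕ (58) ∕ (60) ∕ SBTL: a
contraction in `ℓ^∞`, small chart ball `‖wt‖ ≤ (N⁻¹ − c)r`, two-sided curvature `|u′| ≤ λ`, `2λ ≤ c < N⁻¹`, locality letters) and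
the convexity column's global minimiser ((92)–(94): one-sided `u′ ≥ −λ`, `λ < min(2,a)`, every block field, no locality).  Where
both apply they must agree, because SBTL's closed-ball FIVE say exactly that `σt wt` has block means `wt` and solves the sitewise
equation, and (93) says such a field is unique on the fibre.  So under `λ < min(2,a)` the chart background EXTENDS to the whole coarse
carrier as the fibrewise minimiser of the action; the chart is where the extension is known to be `C¹` with mesh-free letters.

WHAT IS PROVED ([folklore]): **`exists_background_global_extension`** (`d ≥ 3`; SBTL's binders VERBATIM + a primitive `v` of `u` +
`λ < min(2,a)`; every `s ≥ 1`): SBTL's `Q′ ∕ A ∕ σ`, carriers and `σt` re-exported with their actions, `σt 0 = 0`, SBTL's closed-ball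
FIVE, AND a map `Φ` on the whole coarse carrier with: block means `Q′t(Φ w) = w` and the sitewise equation at EVERY `w`; uniqueness
(any torus field with block means `w` solving the sitewise equation IS `Φ w`); minimality (`Φ w` minimises the torus action on its
fibre); `Φ 0 = 0`; and `σt wt = Φ wt` for every `wt` in SBTL's closed chart ball.  §2 toy.

HONEST (what this is NOT).  A junction by name; no new estimate; `Φ` outside the chart ball carries NONE of the sup road's letters
(Lipschitz `(N⁻¹ − c)⁻¹`, `C¹`, locality) — only existence ∕ uniqueness ∕ minimality from convexity; the extra letter `λ < min(2,a)` is
NOT implied by SBTL's; cubic periods; scalar skeleton ((A3), NC-NE7b-α UNRULED); nothing of Bałaban's.  BY-NAME EFFECT ON THE WALL: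
NONE.  NE7b NOT PRINTED ∕ NOT PROVED; spine PROVED 0∕9; rung (B)+1 on a FINITE torus — NOT infinite volume, NOT the mass gap, NOT
Clay.  HONEST DEPENDENCY: continuum YM on T⁴ ⇐ BetaPertH ∧ nine spine estimates (0∕9 proved); BetaPertH ⇐ (D1) ∧ (D4) ∧ CAP+tail;
G-an2-4 gates asym, D1 and NE2∕3∕4.
-/

set_option autoImplicit false

noncomputable section

namespace Summit.QuantumFields.BalabanUV.T4Continuum.NE7b.SupTorusBackgroundGlobalExtension

open Set Metric Function
open scoped ENNReal NNReal Topology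
open Literature.MathematicalPhysics.QuantumFieldTheory.Balaban1983to89
open B4Sect5Proof (latticeConst)
open B6QGQLower276 (X blk B side AX)
open B6QGQDecay237 (deltaU)
open B5Hk103ScalarZd (nbhd deltaH)
open Summit.QuantumFields.BalabanUV.Beta.D1BFx.BlockColumnSupNorm (cHs)
open Summit.QuantumFields.BalabanUV.Beta.D1BFx.PointColumnSplit (cKL cG0 cSplit)
open Summit.QuantumFields.BalabanUV.Beta.D1BFx.PointColumnDecay (cFar)
open Beta (Site siteOf windowMap)
open SupBackgroundTorusLocalised (exists_background_torus_localised)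
open SupTorusActionMinimiser (existsUnique_torus_background)

variable {d : ℕ}

/-! ## §1. The global extension of SBTL's torus background -/

/-- **SBTL's TORUS BACKGROUND EXTENDS TO THE WHOLE COARSE CARRIER** (`d ≥ 3`; SBTL's binders VERBATIM + a primitive `v` of `u` +
`λ < min(2,a)`; every `s ≥ 1`): SBTL's operators, carrier maps and `σt` re-exported with their actions, `σt 0 = 0` and the closed-ball
FIVE, AND `∃ Φ` with, for EVERY coarse field `w`: `Q′t (Φ w) = w`, the sitewise equation at `Φ w`, uniqueness on the fibre, minimality
of the torus action on the fibre; `Φ 0 = 0`; and `σt wt = Φ wt` on SBTL's closed chart ball. [folklore] -/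
theorem exists_background_global_extension (hd : 3 ≤ d) (n : ℕ) {a : ℝ} (ha : 0 < a)
    {v u u' : ℝ → ℝ} (hv : ∀ t, HasDerivAt v (u t) t) (hu : ∀ t, HasDerivAt u (u' t) t) (hu0 : u 0 = 0) {lam c N : ℝ≥0}
    (hlam : ∀ t, |u' t| ≤ lam) {L : ℝ} (hL0 : 0 ≤ L) (hL : ∀ s t, |u' s - u' t| ≤ L * |s - t|)
    (hN : cHs d a * latticeConst d (deltaH d a)
        + ((cG0 d * cKL d (d - 2) + cSplit d a) * Real.exp (2 * deltaU d a)
            + cFar d a * Real.exp (4 * deltaU d a) / deltaU d a ^ 2) * latticeConst d (deltaU d a / 4)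
          * (1 + cHs d a * latticeConst d (deltaH d a)) ≤ (N : ℝ))
    (hc : 2 * lam ≤ c) (hcN : c < N⁻¹) {r : ℝ} (hr : 0 ≤ r) (hγ : (lam : ℝ) < min 2 a) (s : ℕ) [NeZero s] :
    ∃ (Dop Aop : lp (fun _ : X d => ℝ) ∞ →L[ℝ] lp (fun _ : X d => ℝ) ∞)
      (σ : lp (fun _ : X d => ℝ) ∞ → lp (fun _ : X d => ℝ) ∞)
      (Ef : (Site d ((n + 1) * s) → ℝ) →L[ℝ] lp (fun _ : X d => ℝ) ∞)
      (Rf : lp (fun _ : X d => ℝ) ∞ →L[ℝ] (Site d ((n + 1) * s) → ℝ))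
      (Ec : (Site d s → ℝ) →L[ℝ] lp (fun _ : X d => ℝ) ∞)
      (Rc : lp (fun _ : X d => ℝ) ∞ →L[ℝ] (Site d s → ℝ))
      (σt : (Site d s → ℝ) → (Site d ((n + 1) * s) → ℝ))
      (Φ : (Site d s → ℝ) → (Site d ((n + 1) * s) → ℝ)),
      (∀ (f : lp (fun _ : X d => ℝ) ∞) (y : X d), Dop f y = (((n : ℝ) + 1) ^ d)⁻¹ * ∑ p ∈ B n y, f p) ∧
      (∀ (f : lp (fun _ : X d => ℝ) ∞) (p : X d), Aop f p = ∑ r ∈ nbhd n p, AX n a p r * f r) ∧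
      (∀ (g : Site d ((n + 1) * s) → ℝ) (q : X d), Ef g q = g (siteOf d ((n + 1) * s) q)) ∧
      (∀ (h : lp (fun _ : X d => ℝ) ∞) (x : Site d ((n + 1) * s)), Rf h x = h (windowMap d ((n + 1) * s) x)) ∧
      (∀ (g : Site d s → ℝ) (q : X d), Ec g q = g (siteOf d s q)) ∧
      (∀ (h : lp (fun _ : X d => ℝ) ∞) (x : Site d s), Rc h x = h (windowMap d s x)) ∧
      (∀ wt, σt wt = Rf (σ (Ec wt))) ∧ σt 0 = 0 ∧
      -- SBTL's closed-ball FIVE (verbatim)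
      (∀ wt ∈ closedBall (0 : Site d s → ℝ) (((N : ℝ)⁻¹ - c) * r),
        σt wt ∈ closedBall 0 r ∧ Ef (σt wt) = σ (Ec wt) ∧ Dop (Ef (σt wt)) = Ec wt ∧ Rc (Dop (Ef (σt wt))) = wt ∧
          ∀ p : X d, Aop (Ef (σt wt)) p + u (Ef (σt wt) p)
            = (((n : ℝ) + 1) ^ d)⁻¹ * ∑ p' ∈ B n (blk n p), (Aop (Ef (σt wt)) p' + u (Ef (σt wt) p'))) ∧
      -- THE GLOBAL BACKGROUND MAP: block means, sitewise equation, uniqueness, minimality — every `w`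
      (∀ w : Site d s → ℝ, ((Rc.comp Dop).comp Ef) (Φ w) = w ∧
        ∀ p : X d, Aop (Ef (Φ w)) p + u (Ef (Φ w) p)
          = (((n : ℝ) + 1) ^ d)⁻¹ * ∑ p' ∈ B n (blk n p), (Aop (Ef (Φ w)) p' + u (Ef (Φ w) p'))) ∧
      (∀ (w : Site d s → ℝ) (ψ : Site d ((n + 1) * s) → ℝ), ((Rc.comp Dop).comp Ef) ψ = w →
        (∀ p : X d, Aop (Ef ψ) p + u (Ef ψ p)
          = (((n : ℝ) + 1) ^ d)⁻¹ * ∑ p' ∈ B n (blk n p), (Aop (Ef ψ) p' + u (Ef ψ p'))) → ψ = Φ w) ∧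
      (∀ w : Site d s → ℝ,
        IsMinOn (fun φ : Site d ((n + 1) * s) → ℝ => (1 / 2 : ℝ) * ∑ x, φ x * ((Rf.comp Aop).comp Ef) φ x + ∑ x, v (φ x))
          {ψ | ((Rc.comp Dop).comp Ef) ψ = w} (Φ w)) ∧
      Φ 0 = 0 ∧
      -- the junction: on SBTL's closed chart ball the two backgrounds coincide
      ∀ wt ∈ closedBall (0 : Site d s → ℝ) (((N : ℝ)⁻¹ - c) * r), σt wt = Φ wt := by
  obtain ⟨Dop, Aop, Pop, N', σ, Cf, Ef, Rf, Ec, Rc, σt, hD, hA, -, -, -, -, -, -, -, hEf, hRf, hEc, hRc, -, -, -, -,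
    hσt, hσt0, hball, -, -, -⟩ := exists_background_torus_localised hd n ha hu hu0 hlam hL0 hL hN hc hcN hr s
  have hu' : ∀ t, -(lam : ℝ) ≤ u' t := fun t => (abs_le.1 (hlam t)).1
  -- the global background map from (93)'s `∃!`, by choice
  have hglob := fun w : Site d s → ℝ => existsUnique_torus_background n a s hD hA hEf hRf hRc hv hu hu' hγ w
  choose Φ hΦQ hΦeq using fun w : Site d s → ℝ => (hglob w).1.exists
  have huniq : ∀ (w : Site d s → ℝ) (ψ : Site d ((n + 1) * s) → ℝ), ((Rc.comp Dop).comp Ef) ψ = w →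
      (∀ p : X d, Aop (Ef ψ) p + u (Ef ψ p)
        = (((n : ℝ) + 1) ^ d)⁻¹ * ∑ p' ∈ B n (blk n p), (Aop (Ef ψ) p' + u (Ef ψ p'))) → ψ = Φ w :=
    fun w ψ hψQ hψeq => (hglob w).1.unique ⟨hψQ, hψeq⟩ ⟨hΦQ w, hΦeq w⟩
  refine ⟨Dop, Aop, σ, Ef, Rf, Ec, Rc, σt, Φ, hD, hA, hEf, hRf, hEc, hRc, hσt, hσt0, hball, fun w => ⟨hΦQ w, hΦeq w⟩, huniq,
    fun w => (hglob w).2 (Φ w) (hΦQ w) (hΦeq w), ?_, fun wt hwt => ?_⟩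
  · -- `Φ 0 = 0`: the zero field solves the sitewise equation with zero block means (`u 0 = 0`)
    refine (huniq 0 0 (by rw [map_zero]) fun p => ?_).symm
    simp [hu0]
  · -- on the chart ball: SBTL's FIVE say `σt wt` is a fibre solution with block means `wt`
    obtain ⟨-, -, -, hQ, heq⟩ := hball wt hwt
    exact huniq wt (σt wt) (by simpa only [ContinuousLinearMap.comp_apply] using hQ) heq

/-! ## §2. Toy -/

/-- Toy: uniqueness on a fibre in its simplest guise — two elements of a subsingleton fibre are equal. -/
example (w : Unit → ℝ) (φ ψ : Unit → ℝ) (hφ : φ = w) (hψ : ψ = w) : φ = ψ := by rw [hφ, hψ]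

end Summit.QuantumFields.BalabanUV.T4Continuum.NE7b.SupTorusBackgroundGlobalExtension

end
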